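import Literature.NumberTheory.LFunctions.RayClassSmoothedCosets
import HarnessLib

/-!
# Sifted smoothed sums over a coset of a congruence class group (Thorner–Zaman 2017, Lemma 4.6)

Topic `Literature/NumberTheory/LFunctions`, namespace `Literature.NumberTheory.LFunctions.AbelianDensity`.
Everything here is PROVED (one definition with body, theorems; no named facts).

Continuation of `RayClassSmoothedCosets.lean` (TZ Lemma 4.4 / Cor. 4.5 for an abelian Frobenius datum
`f` killing the narrow ray `mod 𝔪`, i.e. for the cosets of a congruence class group `H mod 𝔪`).  We sift
the ideals of a coset `τ` by the prime ideals `𝔭 ∤ 𝔪` of norm `≤ z` with the abstract squarefree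
`Λ²`-sieve `Sieve/SquarefreeSieve.lean`, exactly as the tree's `ClassGroupSiftedSums.sifted_classSum_le`
does for ideal classes (the primes dividing `𝔪` divide no ideal of a coset, so they are left out of the
sifting set; the admissible divisors are `D_z(𝔪) = {S ⊆ P_z : N𝔡_S ≤ z, 𝔡_S prime to 𝔪}`,
`admissibleCoprime`):
* `admissibleCoprime` and its bookkeeping (closed under subsets, contains `∅`, `⊆ admissible K z`,
  `𝔡_S` prime to `𝔪`);
* `sifted_fiberSum_le` — **TZ Lemma 4.6 for a congruence class group**: for `z ≥ 1`, `m ≥ n_K + 3`,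
  `Σ_{F(𝔫)=τ, (𝔫, P_z)=1} N𝔫^{-1} φ(u − log N𝔫) ≤ (κ_K φ(𝔪)/(N𝔪|G|)) / V'_𝔪(z) + |D_z(𝔪)|² · E e^{−3u/2} z`,
  `V'_𝔪(z) = Σ_{S ∈ D_z(𝔪)} 1/N𝔡_S`, `E = (1/3)|d_K| N𝔪² √N𝔪 e^{2n_K} C`, `C = majorConst A m (n_K+1)`.

## References
* [ThornerZaman2017] J. Thorner, A. Zaman, *An explicit bound for the least prime ideal in the Chebotarev
  density theorem*, Algebra Number Theory 11 (2017), Lemma 4.6.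
* [Weiss1983] A. Weiss, *The least prime ideal*, J. reine angew. Math. 338 (1983), Lemma 3.6.
-/

noncomputable section

open Complex Finset IsDedekindDomain NumberField Filter
open scoped Topology

namespace Literature.NumberTheory.LFunctions.AbelianDensity

open Literature.NumberTheory.LFunctions.WeissKernel Literature.NumberTheory.LFunctions.NumberField
  Literature.NumberTheory.Sieve.Squarefree
open scoped nonZeroDivisors _root_.NumberField Classical

variable {K : Type*} [Field K] [NumberField K]

/-! ### Admissible squarefree divisors prime to `𝔪` -/

variable (K) in
/-- The admissible squarefree divisors prime to `𝔪`: `D_z(𝔪) = {S ⊆ P_z : N𝔡_S ≤ z, 𝔭 ∤ 𝔪 (𝔭 ∈ S)}`.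
[cite: ThornerZaman2017, Lemma 4.6] -/
def admissibleCoprime (𝔪 : Ideal (𝓞 K)) (z : ℝ) : Finset (Finset (HeightOneSpectrum (𝓞 K))) :=
  (admissible K z).filter fun S ↦ ∀ v ∈ S, ¬ 𝔪 ≤ v.asIdeal

variable {𝔪 : Ideal (𝓞 K)}

/-- Membership in `admissibleCoprime`. [cite: ThornerZaman2017, Lemma 4.6] -/
theorem mem_admissibleCoprime {z : ℝ} {S : Finset (HeightOneSpectrum (𝓞 K))} :
    S ∈ admissibleCoprime K 𝔪 z ↔ S ∈ admissible K z ∧ ∀ v ∈ S, ¬ 𝔪 ≤ v.asIdeal := by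
  rw [admissibleCoprime, mem_filter]

/-- `D_z(𝔪) ⊆ D_z`. [cite: ThornerZaman2017, Lemma 4.6] -/
theorem admissibleCoprime_subset (z : ℝ) : admissibleCoprime K 𝔪 z ⊆ admissible K z := filter_subset _ _

/-- `D_z(𝔪)` is closed under subsets. [cite: ThornerZaman2017, Lemma 4.6] -/
theorem admissibleCoprime_down {z : ℝ} {S : Finset (HeightOneSpectrum (𝓞 K))} (hS : S ∈ admissibleCoprime K 𝔪 z)
    {T : Finset (HeightOneSpectrum (𝓞 K))} (hT : T ⊆ S) : T ∈ admissibleCoprime K 𝔪 z := by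
  rw [mem_admissibleCoprime] at hS ⊢
  exact ⟨admissible_down hS.1 hT, fun v hv ↦ hS.2 v (hT hv)⟩

/-- `∅ ∈ D_z(𝔪)` for `z ≥ 1`. [cite: ThornerZaman2017, Lemma 4.6] -/
theorem empty_mem_admissibleCoprime {z : ℝ} (hz : 1 ≤ z) :
    (∅ : Finset (HeightOneSpectrum (𝓞 K))) ∈ admissibleCoprime K 𝔪 z := by
  rw [mem_admissibleCoprime]
  exact ⟨empty_mem_admissible hz, fun v hv ↦ absurd hv (Finset.notMem_empty v)⟩

/-- `𝔡_S` is prime to `𝔪` when every `𝔭 ∈ S` is `∤ 𝔪`. [cite: ThornerZaman2017, Lemma 4.6] -/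
theorem isCoprime_sqfIdeal {S : Finset (HeightOneSpectrum (𝓞 K))} (hS : ∀ v ∈ S, ¬ 𝔪 ≤ v.asIdeal) :
    IsCoprime (sqfIdeal S) 𝔪 := by
  rw [sqfIdeal]
  exact IsCoprime.prod_left fun v hv ↦ (isCoprime_of_isMaximal_of_not_le v.isMaximal (hS v hv)).symm

/-! ### The sifted coset sum (TZ Lemma 4.6) -/

section Datum

variable {G : Type*} [CommGroup G] [Finite G] {f : HeightOneSpectrum (𝓞 K) → G}

omit [Finite G] in
/-- The complex sums of `RayClassSmoothedCosets` over the multiples of `𝔡` in a coset are the finite real sums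
over the window `N𝔫 ≤ e^{u + (m+1)/A}`. [cite: ThornerZaman2017, Lemma 4.6] -/
theorem tsum_dvd_fiber_eq_sum (𝔡 : Ideal (𝓞 K)) (τ : G) {A : ℝ} (hA : 0 < A) (m : ℕ) (u : ℝ) :
    ∑' I : Ideal (𝓞 K), (if 𝔡 ∣ I ∧ I ≠ ⊥ ∧ IsCoprime I 𝔪 ∧ artinSymbol f I = τ then (1 : ℂ) else 0) *
        ((Ideal.absNorm I : ℕ) : ℂ)⁻¹ * (phi A m (u - Real.log (Ideal.absNorm I)) : ℂ) =
      ((∑ I ∈ (Ideal.finite_setOf_absNorm_le (S := 𝓞 K) ⌊Real.exp (u + ((m : ℝ) + 1) / A)⌋₊).toFinset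
          with 𝔡 ∣ I,
        (if I ≠ ⊥ ∧ IsCoprime I 𝔪 ∧ artinSymbol f I = τ then (1 : ℝ) else 0) * ((Ideal.absNorm I : ℕ) : ℝ)⁻¹ *
          phi A m (u - Real.log (Ideal.absNorm I)) : ℝ) : ℂ) := by
  rw [tsum_eq_sum (s := (Ideal.finite_setOf_absNorm_le (S := 𝓞 K) ⌊Real.exp (u + ((m : ℝ) + 1) / A)⌋₊).toFinset)]
  · rw [Finset.sum_filter]
    push_cast
    refine Finset.sum_congr rfl fun I _ ↦ ?_
    by_cases hd : 𝔡 ∣ I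
    · rw [if_pos hd]
      by_cases hI : I ≠ ⊥ ∧ IsCoprime I 𝔪 ∧ artinSymbol f I = τ
      · rw [if_pos ⟨hd, hI⟩, if_pos hI]; push_cast; ring
      · rw [if_neg (fun h ↦ hI h.2), if_neg hI]; push_cast; ring
    · rw [if_neg hd, if_neg (fun h ↦ hd h.1), zero_mul, zero_mul]; push_cast; ring
  · intro I hI
    rw [Set.Finite.mem_toFinset, Set.mem_setOf_eq, not_le] at hI
    have : Real.exp (u + ((m : ℝ) + 1) / A) < Ideal.absNorm I := (Nat.floor_lt (Real.exp_pos _).le).mp hI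
    rw [phi_sub_log_eq_zero hA m u this]
    simp

/-- **Thorner–Zaman Lemma 4.6 for a congruence class group `mod 𝔪`** (sifted smoothed coset sum).  Let `f`
be an abelian Frobenius datum killing the narrow ray `mod 𝔪 ≠ 0` whose non-trivial characters are
non-principal on the primes `∤ 𝔪`; let `τ ∈ G`, `z ≥ 1`, `m ≥ n_K + 3`, `A > 0`, `u` real.  Then
`Σ_{F(𝔫) = τ, 𝔭 ∤ 𝔫 (N𝔭 ≤ z, 𝔭 ∤ 𝔪)} N𝔫^{-1} φ(u − log N𝔫) ≤ (κ_K φ(𝔪)/(N𝔪 |G|)) / V'_𝔪(z) + |D_z(𝔪)|² · E e^{−3u/2} z`,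
`V'_𝔪(z) = Σ_{S ∈ D_z(𝔪)} 1/N𝔡_S`, `E = (1/3)|d_K| N𝔪² √N𝔪 e^{2n_K} C` (the sum over the finitely many `𝔫` with
`N𝔫 ≤ e^{u+(m+1)/A}`; the abstract squarefree sieve `Sieve.Squarefree.sifted_sum_le` fed with Cor. 4.5 at the
squarefree `𝔡_{S₁∪S₂}`, `N𝔡 ≤ z²`). [cite: ThornerZaman2017, Lemma 4.6] -/
theorem sifted_fiberSum_le (h𝔪 : 𝔪 ≠ ⊥) (hray : ArtinKillsRay 𝔪 f)
    (hsep : ∀ χ : AddChar (Additive G) ℂ, χ ≠ 0 →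
      ∃ v : HeightOneSpectrum (𝓞 K), ¬ 𝔪 ≤ v.asIdeal ∧ χ (Additive.ofMul (f v)) ≠ 1)
    (τ : G) {A : ℝ} (hA : 0 < A) {m : ℕ} (hm : Module.finrank ℚ K + 3 ≤ m) (u : ℝ) {z : ℝ} (hz : 1 ≤ z) :
    ∑ I ∈ (Ideal.finite_setOf_absNorm_le (S := 𝓞 K) ⌊Real.exp (u + ((m : ℝ) + 1) / A)⌋₊).toFinset
        with (∀ v : HeightOneSpectrum (𝓞 K), (Ideal.absNorm v.asIdeal : ℝ) ≤ z → ¬ 𝔪 ≤ v.asIdeal → ¬ v.asIdeal ∣ I),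
      (if I ≠ ⊥ ∧ IsCoprime I 𝔪 ∧ artinSymbol f I = τ then (1 : ℝ) else 0) * ((Ideal.absNorm I : ℕ) : ℝ)⁻¹ *
        phi A m (u - Real.log (Ideal.absNorm I)) ≤
      (coprimeResidue K 𝔪 h𝔪 / Nat.card G) /
          bigV (fun v : HeightOneSpectrum (𝓞 K) ↦ (Ideal.absNorm v.asIdeal : ℝ)) (admissibleCoprime K 𝔪 z) +
        ((admissibleCoprime K 𝔪 z).card : ℝ) ^ 2 *
          (1 / 3 * ((((NumberField.discr K).natAbs : ℝ) * ((Ideal.absNorm 𝔪 : ℕ) : ℝ) ^ 2 *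
            Real.sqrt (Ideal.absNorm 𝔪 : ℕ)) * Real.exp (2 * Module.finrank ℚ K)) *
            majorConst A m (Module.finrank ℚ K + 1) * Real.exp (-(3 / 2 * u)) * z) := by
  have hz0 : 0 ≤ z := by linarith
  set Nf : HeightOneSpectrum (𝓞 K) → ℝ := fun v ↦ (Ideal.absNorm v.asIdeal : ℝ) with hNf
  have hN : ∀ v, 1 < Nf v := one_lt_absNorm_real
  set Aset := (Ideal.finite_setOf_absNorm_le (S := 𝓞 K) ⌊Real.exp (u + ((m : ℝ) + 1) / A)⌋₊).toFinset
    with hAset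
  set w : Ideal (𝓞 K) → ℝ := fun I ↦ (if I ≠ ⊥ ∧ IsCoprime I 𝔪 ∧ artinSymbol f I = τ then (1 : ℝ) else 0) *
    ((Ideal.absNorm I : ℕ) : ℝ)⁻¹ * phi A m (u - Real.log (Ideal.absNorm I)) with hw
  have hw0 : ∀ I, 0 ≤ w I := by
    intro I; rw [hw]; dsimp only
    refine mul_nonneg (mul_nonneg ?_ (by positivity)) (phi_nonneg hA m _)
    split_ifs <;> norm_num
  set Pz := (primesLE K z).filter (fun v : HeightOneSpectrum (𝓞 K) ↦ ¬ 𝔪 ≤ v.asIdeal) with hPz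
  set dv : Ideal (𝓞 K) → Finset (HeightOneSpectrum (𝓞 K)) := fun I ↦ Pz.filter (·.asIdeal ∣ I) with hdv
  set κr : ℝ := coprimeResidue K 𝔪 h𝔪 / Nat.card G with hκr
  set err : ℝ := 1 / 3 * ((((NumberField.discr K).natAbs : ℝ) * ((Ideal.absNorm 𝔪 : ℕ) : ℝ) ^ 2 *
      Real.sqrt (Ideal.absNorm 𝔪 : ℕ)) * Real.exp (2 * Module.finrank ℚ K)) *
      majorConst A m (Module.finrank ℚ K + 1) * Real.exp (-(3 / 2 * u)) with herr
  have herr0 : 0 ≤ err := by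
    have := majorConst_pos A m (Module.finrank ℚ K + 1); positivity
  have hX : 0 ≤ κr := div_nonneg (coprimeResidue_pos h𝔪).le (Nat.cast_nonneg _)
  -- the local estimate from Cor 4.5
  have hR : ∀ S₁ ∈ admissibleCoprime K 𝔪 z, ∀ S₂ ∈ admissibleCoprime K 𝔪 z,
      |∑ n ∈ Aset.filter (fun n ↦ S₁ ∪ S₂ ⊆ dv n), w n - κr / nrm Nf (S₁ ∪ S₂)| ≤ err * z := by
    intro S₁ h₁ S₂ h₂
    set S := S₁ ∪ S₂ with hS
    have h₁' := mem_admissibleCoprime.mp h₁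
    have h₂' := mem_admissibleCoprime.mp h₂
    have hScop : ∀ v ∈ S, ¬ 𝔪 ≤ v.asIdeal := fun v hv ↦ by
      rcases mem_union.mp hv with h | h
      · exact h₁'.2 v h
      · exact h₂'.2 v h
    have hSP : S ⊆ Pz := fun v hv ↦ by
      rw [hPz, mem_filter]
      refine ⟨?_, hScop v hv⟩
      rcases mem_union.mp hv with h | h
      · exact (mem_admissible.mp h₁'.1).1 h
      · exact (mem_admissible.mp h₂'.1).1 h
    -- the filter condition is `𝔡_S ∣ n`
    have hfil : Aset.filter (fun n ↦ S ⊆ dv n) = Aset.filter (fun n ↦ sqfIdeal S ∣ n) := by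
      refine Finset.filter_congr fun I _ ↦ ?_
      rw [sqfIdeal_dvd_iff]
      constructor
      · intro h v hv
        exact (mem_filter.mp (h hv)).2
      · intro h v hv
        exact mem_filter.mpr ⟨hSP hv, h v hv⟩
    have hsum : ((∑ n ∈ Aset.filter (fun n ↦ S ⊆ dv n), w n : ℝ) : ℂ) =
        ∑' I : Ideal (𝓞 K), (if sqfIdeal S ∣ I ∧ I ≠ ⊥ ∧ IsCoprime I 𝔪 ∧ artinSymbol f I = τ then (1 : ℂ) else 0) *
          ((Ideal.absNorm I : ℕ) : ℂ)⁻¹ * (phi A m (u - Real.log (Ideal.absNorm I)) : ℂ) := by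
      rw [hfil, tsum_dvd_fiber_eq_sum (sqfIdeal S) τ hA m u]
    have hcor := norm_tsum_dvd_fiber_sub_le h𝔪 hray hsep (sqfIdeal_ne_bot S) (isCoprime_sqfIdeal hScop) τ hA hm u
    rw [← hsum] at hcor
    have hnrm : nrm Nf S = ((Ideal.absNorm (sqfIdeal S) : ℕ) : ℝ) := (absNorm_sqfIdeal S).symm
    -- real part
    have hre : ∑ n ∈ Aset.filter (fun n ↦ S ⊆ dv n), w n - κr / nrm Nf S =
        ((((∑ n ∈ Aset.filter (fun n ↦ S ⊆ dv n), w n : ℝ) : ℂ)) -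
          coprimeResidue K 𝔪 h𝔪 / Nat.card G / (Ideal.absNorm (sqfIdeal S) : ℕ)).re := by
      rw [Complex.sub_re, Complex.ofReal_re, Complex.div_natCast_re, hnrm, Complex.div_natCast_re,
        Complex.ofReal_re, hκr]
    rw [hre]
    refine (Complex.abs_re_le_norm _).trans (hcor.trans ?_)
    refine mul_le_mul_of_nonneg_left ?_ herr0
    rw [Real.sqrt_le_left hz0, ← hnrm]
    exact nrm_union_le_sq hz h₁'.1 h₂'.1
  have hmain := sifted_sum_le hN (fun S hS T hT ↦ admissibleCoprime_down hS hT) (empty_mem_admissibleCoprime hz)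
    Aset w hw0 dv hX hR
  -- the sifted condition
  have hfil : Aset.filter (fun n ↦ dv n = ∅) =
      Aset.filter (fun I ↦ ∀ v : HeightOneSpectrum (𝓞 K), (Ideal.absNorm v.asIdeal : ℝ) ≤ z →
        ¬ 𝔪 ≤ v.asIdeal → ¬ v.asIdeal ∣ I) := by
    refine Finset.filter_congr fun I _ ↦ ?_
    rw [hdv]; dsimp only
    rw [Finset.filter_eq_empty_iff]
    constructor
    · intro h v hv hvm hd
      exact h (by rw [hPz, mem_filter]; exact ⟨(mem_primesLE hz0).mpr hv, hvm⟩) hd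
    · intro h v hv hd
      rw [hPz, mem_filter] at hv
      exact h v ((mem_primesLE hz0).mp hv.1) hv.2 hd
  rw [hfil] at hmain
  exact hmain

end Datum

end Literature.NumberTheory.LFunctions.AbelianDensity

end
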